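import Literature.Geometry.Kaehler.ComplexTorusSchollCorrespondenceLefschetz
import HarnessLib

/-!
# Milne 1999, Theorem 5.9 for `Λ`, at torus level and explicitly: Kleiman's operator `Λ` of a complex torus is
# the action of a divisor-class (Lefschetz) correspondence — Scholl's `f_m ∧ p₁^*θ^{s+1}`, resp. `f_n ∧ p₂^*θᵛ`

Layer `Literature/Geometry/Kaehler`, namespace `Literature.Geometry.Kaehler.ComplexTorus`; lane `lit-hodgefound`
(Track 2 foundations library), Layer A4, prover seat `lit-hodgefound-p08` (generation 11, self-proposed row g11-#4
«(g11-#2)⁺ · (g11-#3)⁺ · Q633⁺ (`ComplexTorusKleimanLefschetzOperators`) · (g7-#3)⁺»). Sequel, BY NAME, of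
`ComplexTorusKleimanLefschetzOperators` (Q633: Kleiman's `Λ = kleimanDual η m : H^{m+2}(X) → Hᵐ(X)`, "each `Λ`
peels off one `L`" `kleimanDual_lefschetzPow_succ_of_mem_primitiveForms`, `kleimanDual_eq_zero_of_mem_primitiveForms`,
the Lefschetz-decomposition extensionality `linearMap_ext_of_lefschetzPow`), `ComplexTorusInverseLefschetzKleiman`
(g7-#3: `Λᵗ = kleimanDualPow`, `kleimanDualPow_lefschetzPow_add_of_mem_primitiveForms`),
`ComplexTorusSchollCorrespondenceInverseLefschetz` (g11-#2: `((-1)ⁱ g!/c) · f_i(·) = Λᵗ`, the projection formula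
`corrAct_wedge_domDomCongr`) and `ComplexTorusSchollCorrespondenceLefschetz` (g11-#3: `(f_i)_{2i} ∈ Dⁱ(X × X)`).

## Source, verbatim

J. S. Milne, *Lefschetz classes on abelian varieties*, Duke Math. J. **96** (1999) 639–675, held
`paper:doi-10-1215-s0012-7094-99-09620-5`, p. 664 (p0026 L74–75): "**Theorem 5.9.** Let `A` be an abelian variety
over `Ω`. The correspondences `Λ`, `ᶜΛ`, and `∗` between `A` and itself are all Lefschetz." p. 665 (p0027 L3–8):
"*Proof.* It is known (e.g., Kleiman 1968, p367) that `Λ`, regarded as a map of cohomology groups, is inverse to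
`L`. Since the latter is Lefschetz, it commutes with the action of `L(A)`, which implies that the same is true of
`Λ`, which is therefore Lefschetz. …"; and (L54–L79) Rem. 5.11: "it is possible to show similarly that the
correspondences `Λ`, `ᶜΛ`, `∗` etc. are Lefschetz for rational equivalence … `((-1)ⁱ/√deg(λ_D)) f_i` is the
inverse of the strong Lefschetz isomorphism". Here `Λ` is the operator of p. 664 (display before Thm. 5.9):
`Λ(Σ_i Lⁱ x_i) = Σ_{i ≥ s-d, 1} L^{i-1} x_i` on `Hˢ(X) = ⊕ Lⁱ P^{s-2i}` (the tree's `kleimanDual`, Q633).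

## What is proved (torus level, EXPLICIT form of Thm. 5.9 for `Λ`; theorems only, no definitions, no named facts)

Milne's printed proof goes through the invariant theory of the Lefschetz group (Thm. 4.4 / Cor. 4.5); at torus
level we follow instead the explicit route of Rem. 5.11. For a complex torus `X = E/Φ(ℤ^ι)` of dimension `g`,
a real invariant `2`-form `ξ` (`θ = ofRealForm ξ`, `θ^{∧g} = c · vol_X`), Scholl's `f_i` (g11-#1/#2) acting by
Lange's (6.6) `corrAct`:
* §A (any non-degenerate `η`, `g = dim_ℂ E`) **`kleimanDual_eq_kleimanDualPow_comp_lefschetzPow`: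
  `Λ = Λ^{s+2} ∘ L^{s+1}` on `H^{m+2}(X)`, `m + s + 2 = g`** (below the middle) and
  **`kleimanDual_eq_lefschetzPow_comp_kleimanDualPow`: `Λ = Lᵛ ∘ Λ^{v+1}` on `H^{g+v+1}(X)`, `n + v + 1 = g`**
  (above the middle) — on `Lʳα`, `α` primitive, both sides peel off one `L` (Lefschetz decomposition, Q633/g7-#3).
* §B the second projection formula for the literal action, **`corrAct_wedge_comp_snd_domDomCongr`:
  `(γ ∧ p₂^*β)(x) = β ∧ γ(x)`** for `β` of even degree (`p_{2*}(θ ∧ p₂^*β) = p_{2*}θ ∧ β`, Lange Thm. 6.2.4), and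
  `pushforwardFst_domDomCongr_finCongr`.
* §C **`smul_corrAct_schollF_wedge_comp_fst_eq_kleimanDual`: `Λ = ((-1)ᵐ g!/c) · (f_m ∧ p₁^*θ^{∧(s+1)})(·)` on
  `H^{m+2}(X)`, `m + s + 2 = g`**, and **`smul_corrAct_schollF_wedge_comp_snd_eq_kleimanDual`:
  `Λ = ((-1)ⁿ g!/c) · (f_n ∧ p₂^*θ^{∧v})(·)` on `H^{g+v+1}(X)`, `n + v + 1 = g`** (`c ≠ 0`, `ξ` non-degenerate);
  hence, for `η ∈ NS(X)` non-degenerate, THEOREM 5.9 FOR `Λ`: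
  **`IsNSForm.exists_mem_divisorClasses_smul_corrAct_eq_kleimanDual_of_add_eq`** /
  **`IsNSForm.exists_mem_divisorClasses_smul_corrAct_eq_kleimanDual_of_add_eq'`**: in every degree, Kleiman's
  `Λ : H^{k+2}(X) → Hᵏ(X)` is, up to the scalar `(-1)^• g!/c`, the action of an explicit divisor class
  `γ ∈ D^{g-1}(X × X)` (a `ℚ`-polynomial in `p₁^*η`, `p₂^*η`, `m^*η`); polarised tori (abelian varieties) in the
  printed normalisation `(-1)^•/(d₁⋯d_g)`: `IsRiemannForm.exists_mem_divisorClasses_smul_corrAct_eq_kleimanDual_of_add_eq`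
  / `…'`.

RELATION TO ROW g9-#1/#2 (`ComplexTorusLefschetzAlgebraCorrespondences`, `…AnyBasis`): there Thm. 5.9 is proved IN FULL
by EXISTENCE — for a polarised abelian variety every element of `ℚ⟨L, ᶜΛ⟩` (Kleiman's `Λ`, `∗`, `∗⁻¹`, the primitive
projectors, `Λᵗ`) is `ᵗγ` (`corrMapT`) for SOME `γ ∈ D(X × X)`, by closure of Lefschetz correspondences under
composition (Milne's second half of the proof). The present file adds: the factorisations of §A; an EXPLICIT class
(Scholl's divisor polynomial `f_m ∧ p₁^*θ^{s+1}`, resp. `f_n ∧ p₂^*θᵛ`, the route of Rem. 5.11 — no composition of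
correspondences); the hypotheses (any complex torus with a non-degenerate Néron–Severi class, not necessarily a
polarisation); and the literal action (6.6) `corrAct`.

NOT here: Chow groups; `∗` and `ᶜΛ` explicitly (existence: g9-#1; `ᶜΛ = ᵗ(δ^*c_L)`: g6
`ComplexTorusLefschetzDualCorrespondence`).

## References

* [Milne1999LefschetzClasses] J. S. Milne, *Lefschetz classes on abelian varieties*, Duke Math. J. 96 (1999),
  §5 Thm. 5.9 (p. 664, proof p. 665), Rem. 5.11, p. 664 (display defining `Λ`).
* [Kleiman1968AlgebraicCycles] S. L. Kleiman, *Algebraic cycles and the Weil conjectures* (1968), §1.4, p. 367.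
* [Lange2023AbelianVarietiesComplex] H. Lange, *Abelian Varieties over the Complex Numbers* (2023), §6.2.1 Thm. 6.2.4,
  §6.2.2 (6.6), §7.3.1, §7.3.2.
-/

noncomputable section

open scoped Manifold ContDiff Topology Real
open Set Function Complex Finset Module
open Literature.LinearAlgebra.Alternating
open Literature.LinearAlgebra.Alternating.GForm (of IsHomog)

namespace Literature.Geometry.Kaehler

namespace ComplexTorus

/-! ### §A Kleiman's `Λ` factors through the inverse hard Lefschetz isomorphism -/

section Factor

variable {E : Type*} [NormedAddCommGroup E] [NormedSpace ℂ E] [FiniteDimensional ℂ E]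
  {η : E [⋀^Fin 2]→L[ℝ] ℝ} (hη : ∀ v : E, v ≠ 0 → ∃ w : E, η ![v, w] ≠ 0)

omit [FiniteDimensional ℂ E] in
/-- `Lʳ = L^{r'}` along `r = r'` (transport of the exponent). [cite: Lange2023AbelianVarietiesComplex, §7.3.2] -/
private theorem lefschetzPow_congr'' (η : E [⋀^Fin 2]→L[ℝ] ℝ) {r r' : ℕ} (hr : r = r') {m k : ℕ}
    (h : 2 * r + m = k) (h' : 2 * r' + m = k) (ψ : E [⋀^Fin m]→L[ℝ] ℂ) :
    lefschetzPow η r h ψ = lefschetzPow η r' h' ψ := by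
  subst hr
  rfl

include hη

/-- **Kleiman's `Λ` below the middle degree factors through the inverse of the hard Lefschetz isomorphism:
`Λ = Λ^{s+2} ∘ L^{s+1}` on `H^{m+2}(X)`, `m + s + 2 = g`** (on `Lʳα`, `α` primitive: both sides give
`L^{r-1}α` for `r ≥ 1` — "each `Λ` peels off one `L`" — and `0` for `r = 0`, `L^{s+1}` killing `P^{m+2}`).
[cite: Milne1999LefschetzClasses, §5 p. 664 (display defining Λ), Rem. 5.11] -/
theorem kleimanDual_eq_kleimanDualPow_comp_lefschetzPow {m s : ℕ} (hms : m + s + 2 = finrank ℂ E)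
    (h₁ : 2 * (s + 1) + (m + 2) = m + 2 * (s + 2)) :
    kleimanDual η m = kleimanDualPow η m (s + 2) ∘ₗ lefschetzPow η (s + 1) h₁ := by
  refine linearMap_ext_of_lefschetzPow hη (m := m + 2) (by omega) fun r k hk hr α hα ↦ ?_
  rw [LinearMap.comp_apply, lefschetzPow_lefschetzPow]
  rcases r with _ | r
  · obtain rfl : k = m + 2 := by omega
    rw [lefschetzPow_zero_apply, kleimanDual_eq_zero_of_mem_primitiveForms hη (by omega) hα,
      lefschetzPow_eq_zero_of_mem_primitiveForms (η := η) (j := s) (by omega) (by omega) _ hα, map_zero]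
  · rw [kleimanDual_lefschetzPow_succ_of_mem_primitiveForms hη (by omega) hk (show 2 * r + k = m by omega) hα,
      lefschetzPow_congr'' η (show s + 1 + (r + 1) = r + (s + 2) by omega) _
        (show 2 * (r + (s + 2)) + k = m + 2 * (s + 2) by omega),
      kleimanDualPow_lefschetzPow_add_of_mem_primitiveForms hη (show 2 * r + k = m by omega) hα (s + 2)
        (by omega) _]

/-- **Kleiman's `Λ` above the middle degree: `Λ = Lᵛ ∘ Λ^{v+1}` on `H^{n+2(v+1)}(X) = H^{g+v+1}(X)`, `n + v + 1 = g`**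
(`Λ^{v+1} : H^{g+v+1} ⥲ H^{g-v-1}` the inverse of `L^{v+1}`; on `Lʳα`, `r ≥ v + 1`, both sides give `L^{r-1}α`).
[cite: Milne1999LefschetzClasses, §5 p. 664 (display defining Λ), Rem. 5.11] -/
theorem kleimanDual_eq_lefschetzPow_comp_kleimanDualPow {n v : ℕ} (hnv : n + v + 1 = finrank ℂ E)
    (h : 2 * v + n = n + 2 * v) :
    (kleimanDual η (n + 2 * v) : (E [⋀^Fin (n + 2 * (v + 1))]→L[ℝ] ℂ) →ₗ[ℂ] (E [⋀^Fin (n + 2 * v)]→L[ℝ] ℂ)) =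
      lefschetzPow η v h ∘ₗ kleimanDualPow η n (v + 1) := by
  refine linearMap_ext_of_lefschetzPow hη (m := n + 2 * (v + 1)) (by omega) fun r k hk hr α hα ↦ ?_
  obtain ⟨r, rfl⟩ : ∃ r', r = r' + v + 1 := ⟨r - v - 1, by omega⟩
  -- left: `Λ(L^{r+v+1}α) = L^{r+v}α` (one `L` peeled off)
  have hL : kleimanDual η (n + 2 * v) (lefschetzPow η (r + v + 1) hk α) =
      lefschetzPow η (r + v) (show 2 * (r + v) + k = n + 2 * v by omega) α := by
    rw [lefschetzPow_congr'' η (rfl : r + v + 1 = r + v + 1) hk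
      (show 2 * (r + v + 1) + k = n + 2 * v + 2 by omega)]
    exact kleimanDual_lefschetzPow_succ_of_mem_primitiveForms hη (by omega) _ _ hα
  -- right: `Λ^{v+1}(L^{r+(v+1)}α) = Lʳα`, then `Lᵛ(Lʳα) = L^{r+v}α`
  have hR : kleimanDualPow η n (v + 1) (lefschetzPow η (r + v + 1) hk α) =
      lefschetzPow η r (show 2 * r + k = n by omega) α := by
    rw [lefschetzPow_congr'' η (show r + v + 1 = r + (v + 1) by omega) hk
      (show 2 * (r + (v + 1)) + k = n + 2 * (v + 1) by omega)]
    exact kleimanDualPow_lefschetzPow_add_of_mem_primitiveForms hη _ hα (v + 1) (by omega) _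
  rw [LinearMap.comp_apply, hR, hL, lefschetzPow_lefschetzPow, lefschetzPow_congr'' η (Nat.add_comm v r)]

end Factor

/-! ### §B The second projection formula for the literal action: `(γ ∧ p₂^*β)(x) = β ∧ γ(x)` -/

section Toolkit

variable {ι₁ ι₂ : Type*} [Fintype ι₁] [Fintype ι₂] [DecidableEq ι₁] [DecidableEq ι₂]
  {E₁ E₂ : Type*} [NormedAddCommGroup E₁] [NormedSpace ℂ E₁] [NormedAddCommGroup E₂] [NormedSpace ℂ E₂]
  (Φ₁ : (ι₁ → ℝ) ≃L[ℝ] E₁) (Φ₂ : (ι₂ → ℝ) ≃L[ℝ] E₂)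

/-- `p_{2*}` commutes with re-indexing the second block of arguments. [cite: Lange2023AbelianVarietiesComplex, §6.2.4 (6.10) p. 310] -/
theorem pushforwardFst_domDomCongr_finCongr {N₁ l l' : ℕ} (h : l = l') (e₁ : Fin N₁ ≃ ι₁)
    (θ : (E₁ × E₂) [⋀^Fin (N₁ + l)]→L[ℝ] ℂ) :
    pushforwardFst Φ₁ Φ₂ e₁ (θ.domDomCongr (finCongr (congrArg (N₁ + ·) h))) =
      (pushforwardFst Φ₁ Φ₂ e₁ θ).domDomCongr (finCongr h) := by
  subst h
  rfl

/-- **The second projection formula for Lange's literal action (6.6): `(γ ∧ p₂^*β)(x) = β ∧ γ(x)`** for a class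
`β ∈ Hᵖ(X₂)` of even degree — `p_{2*}((γ ∧ p₂^*β) ∧ p₁^*x) = p_{2*}((γ ∧ p₁^*x) ∧ p₂^*β) = p_{2*}(γ ∧ p₁^*x) ∧ β`
(graded commutativity with even `p`, then `p_{2*}(θ ∧ p₂^*β) = p_{2*}θ ∧ β`, Lange Thm. 6.2.4 for `f = p₂`).
[cite: Lange2023AbelianVarietiesComplex, §6.2.1 Thm. 6.2.4 p. 302, §6.2.2 (6.6) p. 303] -/
theorem corrAct_wedge_comp_snd_domDomCongr {a d l p k : ℕ} (e₁ : Fin (a + d) ≃ ι₁)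
    (γ : (E₁ × E₂) [⋀^Fin (d + l)]→L[ℝ] ℂ) {β : E₂ [⋀^Fin p]→L[ℝ] ℂ} (hp : Even p) (x : E₁ [⋀^Fin a]→L[ℝ] ℂ)
    (h₂ : (d + l) + p = d + k) :
    corrAct Φ₁ Φ₂ e₁
        ((γ.wedge (β.compContinuousLinearMap (ContinuousLinearMap.snd ℝ E₁ E₂))).domDomCongr (finCongr h₂)) x =
      (β.wedge (corrAct Φ₁ Φ₂ e₁ γ x)).domDomCongr (finCongr (by omega : p + l = k)) := by
  obtain rfl : k = p + l := by omega
  have hsign : ((-1 : ℂ) ^ (a * p)) = 1 := (hp.mul_left a).neg_one_pow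
  have hsign' : ((-1 : ℂ) ^ (l * p)) = 1 := (hp.mul_left l).neg_one_pow
  rw [domDomCongr_finCongr_self, corrAct_apply, corrAct_apply, wedge_comm_complex _ β, hsign', one_smul,
    ← pushforwardFst_wedge_comp_snd Φ₁ Φ₂ e₁ _ β, ← pushforwardFst_domDomCongr_finCongr Φ₁ Φ₂ (Nat.add_comm l p)]
  congr 1
  rw [domDomCongr_finCongr_wedge, domDomCongr_finCongr_wedge,
    ContinuousAlternatingMap.WedgeAssoc_holds ℝ (E₁ × E₂) ℂ γ
      (β.compContinuousLinearMap (ContinuousLinearMap.snd ℝ E₁ E₂))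
      (x.compContinuousLinearMap (ContinuousLinearMap.fst ℝ E₁ E₂)),
    wedge_comm_complex (x.compContinuousLinearMap (ContinuousLinearMap.fst ℝ E₁ E₂))
      (β.compContinuousLinearMap (ContinuousLinearMap.snd ℝ E₁ E₂)), hsign, one_smul,
    wedge_domDomCongr_finCongr, wedge_wedge_eq_domDomCongr_assoc₃]
  simp only [domDomCongr_finCongr_trans]

end Toolkit

/-! ### §C Theorem 5.9 for `Λ`, explicitly: `Λ` is the action of a divisor-class correspondence -/

section Lambda

variable {ι : Type*} [Fintype ι] [DecidableEq ι] {E : Type*} [NormedAddCommGroup E] [NormedSpace ℂ E]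
  [FiniteDimensional ℂ E] (Φ : (ι → ℝ) ≃L[ℝ] E) {g : ℕ} (e : Fin (2 * g) ≃ ι) {ξ : E [⋀^Fin 2]→L[ℝ] ℝ}

/-- **`Λ = ((-1)ᵐ g!/c) · (f_m ∧ p₁^*θ^{∧(s+1)})(·)` on `H^{m+2}(X)`, `m + s + 2 = g`** (below the middle degree):
Kleiman's `Λ` is the action (6.6) of the explicit class `f_m ∧ p₁^*θ^{∧(s+1)}` rescaled — `Λ = Λ^{s+2} ∘ L^{s+1}`
(§A), `Λ^{s+2} = ((-1)ᵐ g!/c) · f_m(·)` (g11-#2) and `f_m(θ^{∧(s+1)} ∧ y) = (f_m ∧ p₁^*θ^{∧(s+1)})(y)`.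
[cite: Milne1999LefschetzClasses, §5 Thm. 5.9, Rem. 5.11] -/
theorem smul_corrAct_schollF_wedge_comp_fst_eq_kleimanDual {c : ℂ}
    (hξ : wedgePow (ofRealForm ξ) g = c • volumeForm Φ e) (hc : c ≠ 0)
    (hnd : ∀ v : E, v ≠ 0 → ∃ w : E, ξ ![v, w] ≠ 0) {m s : ℕ} (hms : m + s + 2 = g)
    (h₂ : (m + m) + 2 * (s + 1) = (m + 2 * (s + 1)) + m) (e₂ : Fin ((m + 2) + (m + 2 * (s + 1))) ≃ ι) :
    ((-1) ^ m * Nat.factorial g / c : ℂ) •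
        corrAct Φ Φ e₂
          (((((∑ j ∈ Finset.Icc (m - g) (m / 2),
          ((Nat.factorial j * Nat.factorial (g + j - m) * Nat.factorial (m - 2 * j) : ℕ) : ℂ)⁻¹ •
            ((of 2 ((ofRealForm ξ).compContinuousLinearMap (ContinuousLinearMap.fst ℝ E E)) : GForm (E × E) ℂ) ^ j *
          of 2 ((ofRealForm ξ).compContinuousLinearMap (ContinuousLinearMap.snd ℝ E E)) ^ j *
          of 2 (((ofRealForm ξ).compContinuousLinearMap (ContinuousLinearMap.fst ℝ E E +
              ContinuousLinearMap.snd ℝ E E)) -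
            ((ofRealForm ξ).compContinuousLinearMap (ContinuousLinearMap.fst ℝ E E)) -
            ((ofRealForm ξ).compContinuousLinearMap (ContinuousLinearMap.snd ℝ E E))) ^ (m - 2 * j))) :
        GForm (E × E) ℂ) (m + m)).wedge
              ((wedgePow (ofRealForm ξ) (s + 1)).compContinuousLinearMap (ContinuousLinearMap.fst ℝ E E))).domDomCongr
            (finCongr h₂)) =
      kleimanDual ξ m := by
  have hfr : m + s + 2 = finrank ℂ E := by have := finrank_complex_mul_two Φ e; omega
  have h₁ : 2 * (s + 1) + (m + 2) = m + 2 * (s + 2) := by omega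
  have e₁ : Fin ((m + 2 * (s + 2)) + m) ≃ ι := (finCongr (by omega)).trans e₂
  rw [kleimanDual_eq_kleimanDualPow_comp_lefschetzPow hnd hfr h₁,
    ← smul_corrAct_schollF_eq_kleimanDualPow Φ e hξ hc hnd (show m + (s + 2) = g by omega) e₁]
  refine LinearMap.ext fun y ↦ ?_
  rw [LinearMap.smul_apply, LinearMap.comp_apply, LinearMap.smul_apply, lefschetzPow_apply,
    corrAct_wedge_domDomCongr Φ Φ e₁ e₂ _ _ y h₁ h₂]

/-- **`Λ = ((-1)ⁿ g!/c) · (f_n ∧ p₂^*θ^{∧v})(·)` on `H^{g+v+1}(X) = H^{n+2(v+1)}(X)`, `n + v + 1 = g`** (above the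
middle degree): `Λ = Lᵛ ∘ Λ^{v+1}` (§A), `Λ^{v+1} = ((-1)ⁿ g!/c) · f_n(·)` (g11-#2) and
`θ^{∧v} ∧ f_n(y) = (f_n ∧ p₂^*θ^{∧v})(y)` (§B). [cite: Milne1999LefschetzClasses, §5 Thm. 5.9, Rem. 5.11] -/
theorem smul_corrAct_schollF_wedge_comp_snd_eq_kleimanDual {c : ℂ}
    (hξ : wedgePow (ofRealForm ξ) g = c • volumeForm Φ e) (hc : c ≠ 0)
    (hnd : ∀ v : E, v ≠ 0 → ∃ w : E, ξ ![v, w] ≠ 0) {n v : ℕ} (hnv : n + v + 1 = g)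
    (h₂ : (n + n) + 2 * v = n + (n + 2 * v)) (e₁ : Fin ((n + 2 * (v + 1)) + n) ≃ ι) :
    ((-1) ^ n * Nat.factorial g / c : ℂ) •
        corrAct Φ Φ e₁
          (((((∑ j ∈ Finset.Icc (n - g) (n / 2),
          ((Nat.factorial j * Nat.factorial (g + j - n) * Nat.factorial (n - 2 * j) : ℕ) : ℂ)⁻¹ •
            ((of 2 ((ofRealForm ξ).compContinuousLinearMap (ContinuousLinearMap.fst ℝ E E)) : GForm (E × E) ℂ) ^ j *
          of 2 ((ofRealForm ξ).compContinuousLinearMap (ContinuousLinearMap.snd ℝ E E)) ^ j *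
          of 2 (((ofRealForm ξ).compContinuousLinearMap (ContinuousLinearMap.fst ℝ E E +
              ContinuousLinearMap.snd ℝ E E)) -
            ((ofRealForm ξ).compContinuousLinearMap (ContinuousLinearMap.fst ℝ E E)) -
            ((ofRealForm ξ).compContinuousLinearMap (ContinuousLinearMap.snd ℝ E E))) ^ (n - 2 * j))) :
        GForm (E × E) ℂ) (n + n)).wedge
              ((wedgePow (ofRealForm ξ) v).compContinuousLinearMap (ContinuousLinearMap.snd ℝ E E))).domDomCongr
            (finCongr h₂)) =
      (kleimanDual ξ (n + 2 * v) :
        (E [⋀^Fin (n + 2 * (v + 1))]→L[ℝ] ℂ) →ₗ[ℂ] (E [⋀^Fin (n + 2 * v)]→L[ℝ] ℂ)) := by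
  have hfr : n + v + 1 = finrank ℂ E := by have := finrank_complex_mul_two Φ e; omega
  have h : 2 * v + n = n + 2 * v := by omega
  rw [kleimanDual_eq_lefschetzPow_comp_kleimanDualPow hnd hfr h,
    ← smul_corrAct_schollF_eq_kleimanDualPow Φ e hξ hc hnd (show n + (v + 1) = g by omega) e₁]
  refine LinearMap.ext fun y ↦ ?_
  rw [LinearMap.smul_apply, LinearMap.comp_apply, LinearMap.smul_apply, map_smul, lefschetzPow_apply,
    corrAct_wedge_comp_snd_domDomCongr Φ Φ e₁ _ (even_two_mul v) y h₂]

variable {η : E [⋀^Fin 2]→L[ℝ] ℝ}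

/-- **THEOREM 5.9 (Milne 1999) for `Λ`, at torus level and explicitly — below the middle degree.** For a complex
torus `X` of dimension `g` with a non-degenerate Néron–Severi class `η` (`θ = ofRealForm η`, `θ^{∧g} = c·vol_X`,
`c ≠ 0`) and `m + s + 2 = g`, Kleiman's `Λ : H^{m+2}(X) → Hᵐ(X)` is `((-1)ᵐ g!/c)` times the action of an
explicit divisor class `γ ∈ D^{m+s+1}(X × X) = D^{g-1}(X × X)`, namely `γ = (f_m)_{2m} ∧ p₁^*θ^{∧(s+1)}`
("the correspondence `Λ` … is Lefschetz"). [cite: Milne1999LefschetzClasses, §5 Thm. 5.9, Rem. 5.11] -/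
theorem IsNSForm.exists_mem_divisorClasses_smul_corrAct_eq_kleimanDual_of_add_eq (hη : IsNSForm Φ η)
    (hnd : ∀ v : E, v ≠ 0 → ∃ w : E, η ![v, w] ≠ 0) {c : ℂ} (hc : wedgePow (ofRealForm η) g = c • volumeForm Φ e)
    (hc0 : c ≠ 0) {m s : ℕ} (hms : m + s + 2 = g) (hd : 2 * (m + (s + 1)) = (m + 2 * (s + 1)) + m)
    (e₂ : Fin ((m + 2) + (m + 2 * (s + 1))) ≃ ι) :
    ∃ γ ∈ divisorClasses (prodPeriod Φ Φ) (m + (s + 1)),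
      ((-1) ^ m * Nat.factorial g / c : ℂ) • corrAct Φ Φ e₂ (γ.domDomCongr (finCongr hd)) = kleimanDual η m := by
  have hP : (wedgePow (ofRealForm η) (s + 1)).compContinuousLinearMap (ContinuousLinearMap.fst ℝ E E) ∈
      divisorClasses (prodPeriod Φ Φ) (s + 1) := by
    rw [wedgePow_compContinuousLinearMap, ← ofRealForm_compContinuousLinearMap]
    exact wedgePow_mem_divisorClasses _ (hη.comp_fst Φ) (s + 1)
  refine ⟨_, wedge_mem_divisorClasses _ (hη.schollF_apply_mem_divisorClasses Φ (g := g) m) hP, ?_⟩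
  rw [← smul_corrAct_schollF_wedge_comp_fst_eq_kleimanDual Φ e hc hc0 hnd hms (by omega) e₂,
    schollF_apply_add_self_eq_domDomCongr, domDomCongr_finCongr_wedge, domDomCongr_finCongr_trans,
    domDomCongr_finCongr_trans]

/-- **THEOREM 5.9 (Milne 1999) for `Λ`, at torus level and explicitly — above the middle degree.** With the same
hypotheses and `n + v + 1 = g`, Kleiman's `Λ : H^{g+v+1}(X) → H^{g+v-1}(X)` is `((-1)ⁿ g!/c)` times the action of
the explicit divisor class `γ = (f_n)_{2n} ∧ p₂^*θ^{∧v} ∈ D^{n+v}(X × X) = D^{g-1}(X × X)`.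
[cite: Milne1999LefschetzClasses, §5 Thm. 5.9, Rem. 5.11] -/
theorem IsNSForm.exists_mem_divisorClasses_smul_corrAct_eq_kleimanDual_of_add_eq' (hη : IsNSForm Φ η)
    (hnd : ∀ v : E, v ≠ 0 → ∃ w : E, η ![v, w] ≠ 0) {c : ℂ} (hc : wedgePow (ofRealForm η) g = c • volumeForm Φ e)
    (hc0 : c ≠ 0) {n v : ℕ} (hnv : n + v + 1 = g) (hd : 2 * (n + v) = n + (n + 2 * v))
    (e₁ : Fin ((n + 2 * (v + 1)) + n) ≃ ι) :
    ∃ γ ∈ divisorClasses (prodPeriod Φ Φ) (n + v),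
      ((-1) ^ n * Nat.factorial g / c : ℂ) • corrAct Φ Φ e₁ (γ.domDomCongr (finCongr hd)) =
        (kleimanDual η (n + 2 * v) :
          (E [⋀^Fin (n + 2 * (v + 1))]→L[ℝ] ℂ) →ₗ[ℂ] (E [⋀^Fin (n + 2 * v)]→L[ℝ] ℂ)) := by
  have hP : (wedgePow (ofRealForm η) v).compContinuousLinearMap (ContinuousLinearMap.snd ℝ E E) ∈
      divisorClasses (prodPeriod Φ Φ) v := by
    rw [wedgePow_compContinuousLinearMap, ← ofRealForm_compContinuousLinearMap]
    exact wedgePow_mem_divisorClasses _ (hη.comp_snd Φ) v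
  refine ⟨_, wedge_mem_divisorClasses _ (hη.schollF_apply_mem_divisorClasses Φ (g := g) n) hP, ?_⟩
  rw [← smul_corrAct_schollF_wedge_comp_snd_eq_kleimanDual Φ e hc hc0 hnd hnv (by omega) e₁,
    schollF_apply_add_self_eq_domDomCongr, domDomCongr_finCongr_wedge, domDomCongr_finCongr_trans,
    domDomCongr_finCongr_trans]

end Lambda

end ComplexTorus

end Literature.Geometry.Kaehler
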